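import Summits.AtomisticToContinuum.BoseEinsteinCondensation.Theses.BECHusimiAmplitudeGas
import Summits.AtomisticToContinuum.BoseEinsteinCondensation.Theorems.BECHusimiAmplitudeGasLaplaceCapUnionGauss
import Summits.AtomisticToContinuum.BoseEinsteinCondensation.Theorems.BECHusimiAmplitudeGasLaplaceCapUnionGaussII
import Summits.AtomisticToContinuum.BoseEinsteinCondensation.Theorems.BECHusimiAmplitudeGasLaplaceCapUnionGaussIII
import Summits.AtomisticToContinuum.BoseEinsteinCondensation.Theorems.BECHusimiAmplitudeGasLaplaceCapUnionModes

/-!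
# Route `BECHusimiAmplitudeGas` — support item `LaplaceCapUnion` (stmt-AtomisticToContinuum-11995)

Closes the item: `LaplaceCapUnion := PhaseCapDecay → AmplitudeLDP → HusimiConcentration`,
the bookkeeping of the Laplace principle for the Husimi measure of a nonnegative periodic
near-minimiser on the slow modes.

Proof. Combine the two hypotheses (`ρ₀ = min`, eventual `N` intersected with `N ≥ 7`,
`δ = min`). For a fixed state `Ψ ≥ 0`, with `u_c = ∑ᵢ cᵢ eᵢ` over the `(2R+1)³` normalised plane
waves and `F(g) = ∫_{Λ^N} ∏ⱼ conj g(xⱼ) Ψ`: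
* `F(u_c) = ∑_f (∏ⱼ conj c_{f j}) A_f` is an antiholomorphic form of degree `N`
  (`form_expansion`), so `c ↦ |F(u_c)|²` is measurable, homogeneous of degree `2N`, with finite
  Gaussian mass (`lintegral_gauss_form_sq_ne_top`);
* `⟨u_c, φ₀⟩ = conj c_{i₀}` (`ov_sum_modes`), the top coefficient is `A_{(i₀,…,i₀)} = F(φ₀) ≠ 0`
  (`form_coeff_centre`, `form_constantMode_ne_zero`), and the Bargmann bound
  `E_w|c_{i₀}|^{2N} |F(φ₀)|² ≤ E_w|F(u_c)|²` (`bargmann_lower_bound`) gives non-vanishing and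
  converts the amplitude-far bound (`AmplitudeLDP`, through `|F(u_c)| ≤ F(|u_c|)`,
  `norm_form_integral_le_abs`) into `⅛` of the total mass; the rough-phase cap is `⅛` by
  `PhaseCapDecay`; far cap ⊆ rough-phase ∪ amplitude-far;
* the `ℝ≥0∞` bookkeeping with the radial moment identity (`cap_union_core`) yields
  `(1 + N/2) E_w|F|² ≤ (9/16)(N + d) E_w|F|² ≤ E_w[|⟨u_c,φ₀⟩|² |F|²]`.
-/

noncomputable section

namespace Summit.AtomisticToContinuum.BoseEinsteinCondensation.Theorems

open MeasureTheory
open scoped ENNReal NNReal ComplexConjugate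
open Literature.MathematicalPhysics.QuantumManyBody.BoseGas
open Summit.AtomisticToContinuum.BoseEinsteinCondensation.Theorems.LaplaceCapUnion
open Summit.AtomisticToContinuum.BoseEinsteinCondensation.Theses.BECHusimiAmplitudeGas

/-- **`LaplaceCapUnion`** (item stmt-AtomisticToContinuum-11995 of route `BECHusimiAmplitudeGas`):
`PhaseCapDecay → AmplitudeLDP → HusimiConcentration`. -/
theorem laplaceCapUnion_proof : LaplaceCapUnion := by
  intro hP hA v hv M hM
  obtain ⟨ρ₁, hρ₁, hh1⟩ := hP v hv M hM
  obtain ⟨ρ₂, hρ₂, hh2⟩ := hA v hv M hM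
  refine ⟨min ρ₁ ρ₂, lt_min hρ₁ hρ₂, fun ρ hρ hρlt => ?_⟩
  filter_upwards [hh1 ρ hρ (lt_of_lt_of_le hρlt (min_le_left _ _)),
    hh2 ρ hρ (lt_of_lt_of_le hρlt (min_le_right _ _)), Filter.eventually_ge_atTop 7]
    with N hN1 hN2 hN7
  obtain ⟨δ₁, hδ₁, H1⟩ := hN1
  obtain ⟨δ₂, hδ₂, H2⟩ := hN2
  refine ⟨min δ₁ δ₂, lt_min hδ₁ hδ₂, fun Ψ hΨE hΨpos => ?_⟩
  intro L R e u F ov w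
  -- the two cap bounds for this state
  have K1 : (∫⁻ c : (Fin 3 → Fin (2 * R + 1)) → ℂ, w c *
      (if ‖ov (u c)‖ ^ 2 ≤ 3 / 4 * ∑ i, ‖c i‖ ^ 2 ∧
          7 / 8 * ∑ i, ‖c i‖ ^ 2 < ‖ov (fun x => ((‖u c x‖ : ℝ) : ℂ))‖ ^ 2 then 1 else 0) *
      ((‖F (u c)‖₊ : ℝ≥0∞) ^ 2)) ≤
      1 / 8 * ∫⁻ c : (Fin 3 → Fin (2 * R + 1)) → ℂ, w c * ((‖F (u c)‖₊ : ℝ≥0∞) ^ 2) :=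
    H1 Ψ (hΨE.trans (add_le_add le_rfl (min_le_left _ _))) hΨpos
  have K2 : (∫⁻ c : (Fin 3 → Fin (2 * R + 1)) → ℂ, w c *
      (if ‖ov (fun x => ((‖u c x‖ : ℝ) : ℂ))‖ ^ 2 ≤ 7 / 8 * ∑ i, ‖c i‖ ^ 2 then 1 else 0) *
      ((‖F (fun x => ((‖u c x‖ : ℝ) : ℂ))‖₊ : ℝ≥0∞) ^ 2)) ≤
      1 / 8 * (∫⁻ c : (Fin 3 → Fin (2 * R + 1)) → ℂ, w c * ((‖ov (u c)‖₊ : ℝ≥0∞) ^ (2 * N))) *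
        ((‖F (constantMode L)‖₊ : ℝ≥0∞) ^ 2) :=
    H2 Ψ (hΨE.trans (add_le_add le_rfl (min_le_right _ _))) hΨpos
  -- basic facts
  have hNpos : 0 < N := by omega
  have hL : 0 < L := Real.rpow_pos_of_pos (div_pos (by exact_mod_cast hNpos) hρ) _
  set i₀ : Fin 3 → Fin (2 * R + 1) := fun _ => ⟨R, by omega⟩ with hi₀_def
  have he_cont : ∀ i, Continuous (e i) := fun i =>
    (continuous_cellWave L _).div_const _
  have he_meas : ∀ i, Measurable (e i) := fun i => (he_cont i).measurable
  have hψc : Continuous Ψ.ψ := Ψ.contDiff.continuous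
  -- the antiholomorphic form
  set A : (Fin N → (Fin 3 → Fin (2 * R + 1))) → ℂ := fun f =>
    ∫ X in cellN N L, (∏ j, conj (e (f j) (X j))) * Ψ.ψ X with hA_def
  have hFP : ∀ c, F (u c) = ∑ f : Fin N → (Fin 3 → Fin (2 * R + 1)), (∏ j, conj (c (f j))) * A f :=
    fun c => form_expansion e he_cont hψc L c
  have hov : ∀ c, ‖ov (u c)‖ = ‖c i₀‖ := fun c => by
    show ‖∫ x in cell L, conj (∑ i, c i * (cellWave L (fun k => ((i k : ℕ) : ℤ) - (R : ℤ)) x /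
      (Real.sqrt (L ^ 3) : ℂ))) * constantMode L x‖ = _
    rw [ov_sum_modes hL c, Complex.norm_conj]
  have hovnn : ∀ c, (‖ov (u c)‖₊ : ℝ≥0∞) = ‖c i₀‖₊ := fun c => by
    rw [← enorm_eq_nnnorm, ← enorm_eq_nnnorm, ← ofReal_norm, ← ofReal_norm, hov c]
  have hA0 : A (fun _ => i₀) = F (constantMode L) := form_coeff_centre L R Ψ.ψ
  have hFconst : F (constantMode L) ≠ 0 := form_constantMode_ne_zero hL Ψ hΨpos
  -- ingredients of the core lemma
  have hGm : Measurable fun c : (Fin 3 → Fin (2 * R + 1)) → ℂ => ((‖F (u c)‖₊ : ℝ≥0∞) ^ 2) := by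
    have : (fun c : (Fin 3 → Fin (2 * R + 1)) → ℂ => ((‖F (u c)‖₊ : ℝ≥0∞) ^ 2)) =
        fun c => ((‖∑ f : Fin N → (Fin 3 → Fin (2 * R + 1)), (∏ j, conj (c (f j))) * A f‖₊ :
          ℝ≥0∞) ^ 2) := funext fun c => by rw [hFP c]
    rw [this]
    exact measurable_nnnorm_form_sq A
  have hom : ∀ t : ℝ, 0 < t → ∀ c : (Fin 3 → Fin (2 * R + 1)) → ℂ,
      ((‖F (u (t • c))‖₊ : ℝ≥0∞) ^ 2) = ENNReal.ofReal (t ^ (2 * N)) * ((‖F (u c)‖₊ : ℝ≥0∞) ^ 2) := by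
    intro t ht c
    rw [hFP (t • c), hFP c]
    exact nnnorm_form_sq_smul A ht c
  have hGabs : ∀ c : (Fin 3 → Fin (2 * R + 1)) → ℂ, ((‖F (u c)‖₊ : ℝ≥0∞) ^ 2) ≤
      ((‖F (fun x => ((‖u c x‖ : ℝ) : ℂ))‖₊ : ℝ≥0∞) ^ 2) := by
    intro c
    have h := norm_form_integral_le_abs hΨpos (u c) L
    gcongr
    exact_mod_cast h
  have hmeas_ov : Measurable fun c : (Fin 3 → Fin (2 * R + 1)) → ℂ => ‖ov (u c)‖ ^ 2 := by
    simp_rw [hov]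
    fun_prop
  have hmeas_ovabs : Measurable fun c : (Fin 3 → Fin (2 * R + 1)) → ℂ =>
      ‖ov (fun x => ((‖u c x‖ : ℝ) : ℂ))‖ ^ 2 :=
    (measurable_ov_abs e he_meas L).norm.pow_const 2
  have hmeas_q : Measurable fun c : (Fin 3 → Fin (2 * R + 1)) → ℂ => ∑ i, ‖c i‖ ^ 2 := by
    fun_prop
  have hχPm : Measurable fun c : (Fin 3 → Fin (2 * R + 1)) → ℂ =>
      (if ‖ov (u c)‖ ^ 2 ≤ 3 / 4 * ∑ i, ‖c i‖ ^ 2 ∧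
          7 / 8 * ∑ i, ‖c i‖ ^ 2 < ‖ov (fun x => ((‖u c x‖ : ℝ) : ℂ))‖ ^ 2 then (1 : ℝ≥0∞) else 0) := by
    refine Measurable.ite ?_ measurable_const measurable_const
    exact (measurableSet_le hmeas_ov (hmeas_q.const_mul _)).inter
      (measurableSet_lt (hmeas_q.const_mul _) hmeas_ovabs)
  have hcover : ∀ c : (Fin 3 → Fin (2 * R + 1)) → ℂ, ‖ov (u c)‖ ^ 2 ≤ 3 / 4 * ∑ i, ‖c i‖ ^ 2 →
      1 ≤ (if ‖ov (u c)‖ ^ 2 ≤ 3 / 4 * ∑ i, ‖c i‖ ^ 2 ∧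
          7 / 8 * ∑ i, ‖c i‖ ^ 2 < ‖ov (fun x => ((‖u c x‖ : ℝ) : ℂ))‖ ^ 2 then (1 : ℝ≥0∞) else 0) +
        (if ‖ov (fun x => ((‖u c x‖ : ℝ) : ℂ))‖ ^ 2 ≤ 7 / 8 * ∑ i, ‖c i‖ ^ 2 then (1 : ℝ≥0∞) else 0) := by
    intro c hc
    by_cases hB : ‖ov (fun x => ((‖u c x‖ : ℝ) : ℂ))‖ ^ 2 ≤ 7 / 8 * ∑ i, ‖c i‖ ^ 2
    · rw [if_pos hB]
      exact le_add_left le_rfl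
    · have hA' : ‖ov (u c)‖ ^ 2 ≤ 3 / 4 * ∑ i, ‖c i‖ ^ 2 ∧
          7 / 8 * ∑ i, ‖c i‖ ^ 2 < ‖ov (fun x => ((‖u c x‖ : ℝ) : ℂ))‖ ^ 2 := ⟨hc, not_le.1 hB⟩
      rw [if_neg hB, if_pos hA', add_zero]
  have hX : ∫⁻ c : (Fin 3 → Fin (2 * R + 1)) → ℂ, w c * ((‖ov (u c)‖₊ : ℝ≥0∞) ^ (2 * N)) =
      ∫⁻ c : (Fin 3 → Fin (2 * R + 1)) → ℂ, w c * ((‖c i₀‖₊ : ℝ≥0∞) ^ (2 * N)) :=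
    lintegral_congr fun c => by rw [hovnn c]
  have hI : ∫⁻ c : (Fin 3 → Fin (2 * R + 1)) → ℂ, w c * ((‖F (u c)‖₊ : ℝ≥0∞) ^ 2) =
      ∫⁻ c : (Fin 3 → Fin (2 * R + 1)) → ℂ, w c *
        ((‖∑ f : Fin N → (Fin 3 → Fin (2 * R + 1)), (∏ j, conj (c (f j))) * A f‖₊ : ℝ≥0∞) ^ 2) :=
    lintegral_congr fun c => by rw [hFP c]
  have hBarg : (∫⁻ c : (Fin 3 → Fin (2 * R + 1)) → ℂ, w c * ((‖ov (u c)‖₊ : ℝ≥0∞) ^ (2 * N))) *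
      ((‖F (constantMode L)‖₊ : ℝ≥0∞) ^ 2) ≤
      ∫⁻ c : (Fin 3 → Fin (2 * R + 1)) → ℂ, w c * ((‖F (u c)‖₊ : ℝ≥0∞) ^ 2) := by
    rw [hX, hI, ← hA0]
    exact bargmann_lower_bound i₀ N A
  have hfin : ∫⁻ c : (Fin 3 → Fin (2 * R + 1)) → ℂ, w c * ((‖F (u c)‖₊ : ℝ≥0∞) ^ 2) ≠ ⊤ := by
    rw [hI]
    exact lintegral_gauss_form_sq_ne_top A
  have hmain := cap_union_core (i₀ := i₀) K1 K2 hN7 hGm hom hGabs hχPm hov hcover hBarg hfin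
  refine ⟨?_, hfin, hmain⟩
  -- non-vanishing
  intro h0
  rw [h0, nonpos_iff_eq_zero, mul_eq_zero] at hBarg
  rcases hBarg with hB | hB
  · rw [hX] at hB
    exact lintegral_gauss_pow_ne_zero i₀ (2 * N) hB
  · exact hFconst (by simpa using hB)

end Summit.AtomisticToContinuum.BoseEinsteinCondensation.Theorems
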